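import Literature.Probability.LatticeModels.FlatBoundaryPoissonKernelLimit
import Literature.Probability.LatticeModels.FlatBoundaryGreenAPriori
import Literature.Probability.LatticeModels.LatticeHarmonicCompactness
import Literature.Probability.LatticeModels.DiscreteHarmonicLimit
import Literature.Probability.RandomPlanarGeometry.JordanBoundaryPoleHarmonic
import Literature.Analysis.Complex.FlatBoundaryPoissonExpansion
import Literature.Analysis.Complex.DerivNeZeroOfHalfDisc
import HarnessLib

/-!
# Proof of `ChelkakSmirnov2011_boundaryNormalisedPoissonKernelLimit` (assembly, part B)

(Sibling proofs file of `FlatBoundaryPoissonKernelLimit.lean`; the other sibling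
`FlatBoundaryPoissonKernelLimitProofs.lean` discharges Kenyon's fact of the same statement file.)

Topic `Literature/Probability/LatticeModels`. The continuum half and the assembly of the proof of
D. Chelkak, S. Smirnov, *Discrete complex analysis on isoradial graphs*, Adv. Math. 228 (2011),
Thm. 3.13, square-lattice / flat-boundary case (tree fact
`ChelkakSmirnov2011_boundaryNormalisedPoissonKernelLimit`, file `FlatBoundaryPoissonKernelLimit.lean`),
following the architecture of the printed proof (§3.5): with `P n = G(·, b n) δ n / G(a n, b n)`,

1. (compactness, Prop. 3.1) a subsequence of the step functions of `P n` converges uniformly on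
   compacts of `D` to a continuous `H` (`LatticeHarmonicCompactness`, the a priori bounds of
   `FlatBoundaryGreenAPriori`);
2. (harmonicity) `H` is harmonic (`DiscreteHarmonicLimit`), `H ≥ 0`, and `H → 0` at every
   boundary point but the pole (`eventually_ratio_le_near`, weak Beurling);
3. (identification) `H = m · Im w/|w - w(y)|²` (`JordanBoundaryPoleHarmonic`, Carathéodory +
   Herglotz on the disc);
4. (normalisation, Lemma 3.12) `m · |w′(x)|/|w(x) - w(y)|² = 1` by the rectangle squeeze at the
   normalisation point (`RectangleSideHarmonicMeasure.top_ge_neg_of_squeeze`/`top_le_of_squeeze`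
   and the expansion `FlatBoundaryPoissonExpansion.abs_poisson_sub_mul_le`);
5. every subsequence has such a further subsequence, whence convergence of the whole sequence.

Everything is proved.
-/

noncomputable section

namespace Literature.Probability.LatticeModels

open _root_.Complex Metric Set _root_.Filter _root_.Topology Orient WeakBeurling Real
open Literature.Probability.RandomPlanarGeometry InnerProductSpace

/-! ### Continuity of the normal coordinate; the limit kernel -/

/-- `nrmC o` is continuous. [folklore] -/
theorem continuous_nrmC (o : Orient) : Continuous (nrmC o) := by
  cases o
  · exact Complex.continuous_im
  · exact Complex.continuous_im.neg
  · exact Complex.continuous_re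
  · exact Complex.continuous_re.neg

/-- The conformal Poisson kernel `z ↦ Im w(z)/|w(z) - w(y)|²` is continuous on `D` when `w` is
continuous on `D`, maps `D` into `ℍ`, and `w y` is real. [folklore] -/
theorem continuousOn_poissonConf {w : ℂ → ℂ} {D : Set ℂ} (hw : ContinuousOn w D)
    (hmaps : MapsTo w D {z : ℂ | 0 < z.im}) {y : ℂ} (hy : (w y).im = 0) (m : ℝ) :
    ContinuousOn (fun z => m * ((w z).im / ‖w z - w y‖ ^ 2)) D := by
  refine continuousOn_const.mul ((Complex.continuous_im.comp_continuousOn hw).div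
    ((continuous_norm.comp_continuousOn (hw.sub continuousOn_const)).pow 2) fun z hz => ?_)
  have h1 : 0 < (w z).im := hmaps hz
  have h2 : w z - w y ≠ 0 := by
    intro h; rw [sub_eq_zero] at h; rw [h, hy] at h1; exact lt_irrefl _ h1
  positivity

section Limit

variable {δ : ℕ → ℝ} {V : ℕ → Finset (Site 2)}

/-- **Step 1–3: extraction and identification of subsequential limits.** Along the sequence, with
`P n z = G_{V n}(z, b n) δ n / G_{V n}(a n, b n)` and the lower bound `κ δ² ≤ G(a, b)`: there are a
subsequence `φ` and `m ≥ 0` such that the step functions `z ↦ P (φ n) (nearestSite (δ (φ n)) z)`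
converge, uniformly on every compact subset of `D`, to `m · Im w/|w - w(y)|²`.
(Chelkak–Smirnov 2011, proof of Thm. 3.13: compactness by Prop. 3.1, harmonicity of the limit,
boundary values `0` off the pole by the weak Beurling estimate, identification of a nonnegative
harmonic function vanishing on `∂D ∖ {y}`.) [cite: ChelkakSmirnov2011, proof of Thm. 3.13] -/
theorem exists_subseq_tendstoUniformlyOn_kernel (Dj : JordanDomain)
    (hrect : ∃ S : Finset (ℂ × ℂ), (∀ q ∈ S, q.1.re = q.2.re ∨ q.1.im = q.2.im) ∧
      frontier Dj.carrier ⊆ ⋃ q ∈ S, segment ℝ q.1 q.2)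
    (hδ : ∀ n, 0 < δ n) (hδ0 : Tendsto δ atTop (𝓝 0))
    (hV : ∀ n (v : Site 2), v ∈ V n ↔ meshPoint (δ n) v ∈ closure Dj.carrier)
    {y : ℂ} (hy : y ∈ frontier Dj.carrier) (oy : Orient) {r₀ : ℝ} (hr₀ : 0 < r₀)
    (hsy : ∀ z, dist z y < r₀ → (z ∈ closure Dj.carrier ↔ nrmC oy y ≤ nrmC oy z))
    {a b : ℕ → Site 2}
    (hb : ∀ n, b n ∈ V n ∧ (((zdGraph 2).neighborFinset (b n)).filter (fun u => u ∉ V n)).card = 1)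
    (hby : Tendsto (fun n => meshPoint (δ n) (b n)) atTop (𝓝 y))
    {κ : ℝ} (hκ : 0 < κ) (hlow : ∀ᶠ n in atTop, κ * δ n ^ 2 ≤ dirichletGreen (V n) (a n) (b n))
    {w : ℂ → ℂ} {U : Set ℂ} (hU : IsOpen U) (hDU : Dj.carrier ⊆ U) (hyU : y ∈ U)
    (hw : DifferentiableOn ℂ w U) (hbij : BijOn w Dj.carrier {z : ℂ | 0 < z.im}) :
    ∃ φ : ℕ → ℕ, StrictMono φ ∧ ∃ m : ℝ, 0 ≤ m ∧ ∀ K ⊆ Dj.carrier, IsCompact K →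
      TendstoUniformlyOn (fun n z => dirichletGreen (V (φ n)) (nearestSite (δ (φ n)) z) (b (φ n)) * δ (φ n) /
        dirichletGreen (V (φ n)) (a (φ n)) (b (φ n)))
        (fun z => m * ((w z).im / ‖w z - w y‖ ^ 2)) atTop K := by
  set D := Dj.carrier with hDdef
  have hDo : IsOpen D := Dj.isOpen
  set P : ℕ → Site 2 → ℝ := fun n z => dirichletGreen (V n) z (b n) * δ n / dirichletGreen (V n) (a n) (b n) with hP
  have hP0 : ∀ n z, 0 ≤ P n z := fun n z => ratio_nonneg _ _ _ _ (hδ n).le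
  -- harmonicity at interior sites
  have hharm : ∀ n (v : Site 2), closedBall (meshPoint (δ n) v) (δ n) ⊆ D → latticeLaplacian (P n) v = 0 :=
    fun n v hv => latticeLaplacian_ratio _ _ _ _ (mem_diff_of_closedBall_subset (hδ n) (hV n) (hb n).2 hv)
  -- local bounds
  have hbdd : ∀ K ⊆ D, IsCompact K → ∃ M : ℝ, ∀ᶠ n in atTop, ∀ v : Site 2,
      meshPoint (δ n) v ∈ K → |P n v| ≤ M := by
    intro K hKD hK
    rcases K.eq_empty_or_nonempty with rfl | hKne
    · exact ⟨0, Eventually.of_forall fun n v hv => (notMem_empty _ hv).elim⟩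
    have hyK : y ∉ closure K := by
      rw [hK.isClosed.closure_eq]
      intro hyK
      have : y ∈ D ∩ frontier D := ⟨hKD hyK, hy⟩
      rw [hDo.inter_frontier_eq] at this
      exact this
    have hdK : 0 < infDist y K := (infDist_pos_iff_notMem_closure hKne).1 hyK
    set d := min (infDist y K) (r₀ / 4) with hd
    have hd0 : 0 < d := by positivity
    refine ⟨64 * flatPoleConst / (κ * d), ?_⟩
    filter_upwards [eventually_ratio_le oy hδ hδ0 hV hr₀ hsy hb hby hκ hlow hd0 (min_le_right _ _)] with n hn v hv
    rw [abs_of_nonneg (hP0 n v)]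
    refine hn v ((min_le_left _ _).trans ?_)
    rw [dist_comm]; exact infDist_le_dist_of_mem hv
  -- extraction
  obtain ⟨φ, hφ, H, hHc, hconv⟩ := exists_subseq_tendstoUniformlyOn_of_latticeHarmonic hDo hδ hδ0 P hharm hbdd
  have hφt : Tendsto φ atTop atTop := hφ.tendsto_atTop
  -- pointwise limits at points of `D`
  have hpt : ∀ z ∈ D, Tendsto (fun n => P (φ n) (nearestSite (δ (φ n)) z)) atTop (𝓝 (H z)) := by
    intro z hz
    have h := hconv {z} (singleton_subset_iff.2 hz) isCompact_singleton
    exact h.tendsto_at (mem_singleton z)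
  -- `H ≥ 0`
  have hH0 : ∀ z ∈ D, 0 ≤ H z := fun z hz =>
    ge_of_tendsto' (hpt z hz) fun n => hP0 _ _
  -- `H` is harmonic
  have hHharm : HarmonicOnNhd H D := by
    intro z₀ hz₀
    obtain ⟨R₂, hR₂, hballR₂⟩ := Metric.isOpen_iff.1 hDo z₀ hz₀
    set R := R₂ / 3 with hR
    have hR0 : 0 < R := by positivity
    have hcl : closedBall z₀ (2 * R) ⊆ D := fun z hz => hballR₂ (by
      rw [mem_closedBall] at hz; rw [mem_ball]; linarith)
    have hclR : closedBall z₀ R ⊆ D := (closedBall_subset_closedBall (by linarith)).trans hcl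
    -- a tail with small mesh
    obtain ⟨N, hN⟩ := eventually_atTop.1 ((hδ0.comp hφt).eventually (gt_mem_nhds hR0))
    have hu : ∀ n (v : Site 2), meshPoint (δ (φ (n + N))) v ∈ ball z₀ R →
        latticeLaplacian (P (φ (n + N))) v = 0 := by
      intro n v hv
      apply hharm
      intro p hp
      apply hcl
      rw [mem_closedBall] at hp ⊢
      rw [mem_ball] at hv
      have := hN (n + N) (by omega)
      simp only [Function.comp] at this
      calc dist p z₀ ≤ dist p (meshPoint (δ (φ (n + N))) v) + dist (meshPoint (δ (φ (n + N))) v) z₀ := dist_triangle _ _ _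
        _ ≤ 2 * R := by linarith
    have hconvR : ∀ ε > 0, ∀ᶠ n in atTop, ∀ v : Site 2, meshPoint (δ (φ (n + N))) v ∈ closedBall z₀ R →
        |P (φ (n + N)) v - H (meshPoint (δ (φ (n + N))) v)| ≤ ε := by
      intro ε hε
      have h1 := (Metric.tendstoUniformlyOn_iff.1 (hconv _ hclR (isCompact_closedBall _ _))) ε hε
      have h2 := (tendsto_add_atTop_nat N).eventually h1
      filter_upwards [h2] with n hn v hv
      have := hn _ hv
      rw [nearestSite_meshPoint (hδ _).ne', dist_comm, Real.dist_eq] at this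
      exact this.le
    have hharmR := harmonicOnNhd_of_latticeHarmonic_limit hR0 (hHc.mono hclR)
      (fun n => hδ (φ (n + N))) ((hδ0.comp hφt).comp (tendsto_add_atTop_nat N)) hu hconvR
    exact hharmR z₀ (mem_ball_self hR0)
  -- `H → 0` at the boundary off the pole
  have hlim : ∀ ζ ∈ frontier D, ζ ≠ y → Tendsto H (𝓝[D] ζ) (𝓝 0) := by
    intro ζ hζ hζy
    rw [Metric.tendsto_nhdsWithin_nhds]
    intro ε hε
    obtain ⟨ρ₀, hρ₀, hnear⟩ := eventually_ratio_le_near Dj hrect oy hδ hδ0 hV hr₀ hsy hb hby hκ hlow hζ hζy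
      (half_pos hε)
    refine ⟨ρ₀ / 2, by positivity, fun z hz hzζ => ?_⟩
    rw [Real.dist_0_eq_abs, abs_of_nonneg (hH0 z hz)]
    -- the nearest sites of `z` are eventually in `V` and close to `ζ`
    obtain ⟨η, hη, hηD⟩ := Metric.isOpen_iff.1 hDo z hz
    have hev : ∀ᶠ n in atTop, P (φ n) (nearestSite (δ (φ n)) z) ≤ ε / 2 := by
      have h1 := hφt.eventually hnear
      have h2 := (hδ0.comp hφt).eventually (gt_mem_nhds (show 0 < min η (ρ₀ / 2) by positivity))
      filter_upwards [h1, h2] with n hn1 hn2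
      simp only [Function.comp] at hn2
      have hd := dist_meshPoint_nearestSite_le (hδ (φ n)) z
      refine hn1 _ ((hV _ _).2 (subset_closure (hηD ?_))) ?_
      · rw [mem_ball]; exact lt_of_le_of_lt hd (lt_of_lt_of_le hn2 (min_le_left _ _))
      · calc dist (meshPoint (δ (φ n)) (nearestSite (δ (φ n)) z)) ζ
            ≤ dist (meshPoint (δ (φ n)) (nearestSite (δ (φ n)) z)) z + dist z ζ := dist_triangle _ _ _
          _ < ρ₀ := by linarith [lt_of_lt_of_le hn2 (min_le_right _ _)]
    have := le_of_tendsto (hpt z hz) hev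
    linarith
  -- identification
  obtain ⟨m, hm0, hHm⟩ := Dj.eq_mul_im_div_of_tendsto_zero hU hDU hy hyU hw hbij hHharm hH0 hlim
  refine ⟨φ, hφ, m, hm0, fun K hKD hK => (hconv K hKD hK).congr_right fun z hz => hHm z (hKD hz)⟩

end Limit

/-! ### The normalisation: an abstract squeeze and the rectangle at the normalisation point -/

section Squeeze

/-- **Abstract squeeze.** If `|A| t ≤ B t²/s² + C s t` for all `0 < t`, `3t ≤ s ≤ ρ`, then `A = 0`
(choose `s` small, then `t ≪ s²`). [folklore] -/
theorem eq_zero_of_squeeze {A B C ρ : ℝ} (hB : 0 ≤ B) (hC : 0 ≤ C) (hρ : 0 < ρ)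
    (h : ∀ s t : ℝ, 0 < t → 3 * t ≤ s → s ≤ ρ → |A| * t ≤ B * (t ^ 2 / s ^ 2) + C * (s * t)) : A = 0 := by
  by_contra hA
  have ha : 0 < |A| := abs_pos.2 hA
  set s := min ρ (|A| / (4 * (C + 1))) with hs
  have hs0 : 0 < s := by positivity
  have hsρ : s ≤ ρ := min_le_left _ _
  have hsC : s ≤ |A| / (4 * (C + 1)) := min_le_right _ _
  set t := min (s / 3) (|A| * s ^ 2 / (4 * (B + 1))) with ht
  have ht0 : 0 < t := by positivity
  have ht3 : 3 * t ≤ s := by have := min_le_left (s / 3) (|A| * s ^ 2 / (4 * (B + 1))); linarith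
  have htB : t ≤ |A| * s ^ 2 / (4 * (B + 1)) := min_le_right _ _
  have key := h s t ht0 ht3 hsρ
  -- `B t²/s² ≤ |A| t / 4`
  have h1 : B * (t ^ 2 / s ^ 2) ≤ |A| / 4 * t := by
    have hs2 : 0 < s ^ 2 := by positivity
    have e1 : B * (t ^ 2 / s ^ 2) = (B * (t / s ^ 2)) * t := by field_simp
    rw [e1]
    refine mul_le_mul_of_nonneg_right ?_ ht0.le
    have e2 : t / s ^ 2 ≤ |A| / (4 * (B + 1)) := by
      rw [div_le_iff₀ hs2]
      calc t ≤ |A| * s ^ 2 / (4 * (B + 1)) := htB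
        _ = |A| / (4 * (B + 1)) * s ^ 2 := by ring
    calc B * (t / s ^ 2) ≤ B * (|A| / (4 * (B + 1))) := mul_le_mul_of_nonneg_left e2 hB
      _ = (B / (B + 1)) * (|A| / 4) := by field_simp
      _ ≤ 1 * (|A| / 4) := by
          apply mul_le_mul_of_nonneg_right _ (by positivity)
          rw [div_le_one (by positivity)]; linarith
      _ = |A| / 4 := one_mul _
  -- `C s t ≤ |A| t / 4`
  have h2 : C * (s * t) ≤ |A| / 4 * t := by
    rw [← mul_assoc]
    refine mul_le_mul_of_nonneg_right ?_ ht0.le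
    calc C * s ≤ C * (|A| / (4 * (C + 1))) := mul_le_mul_of_nonneg_left hsC hC
      _ = (C / (C + 1)) * (|A| / 4) := by field_simp
      _ ≤ 1 * (|A| / 4) := by
          apply mul_le_mul_of_nonneg_right _ (by positivity)
          rw [div_le_one (by positivity)]; linarith
      _ = |A| / 4 := one_mul _
  have : |A| * t ≤ |A| / 2 * t := by linarith
  nlinarith

/-- The lattice Laplacian of an affine function of the second coordinate vanishes. [folklore] -/
theorem latticeLaplacian_affine_snd (d c : ℝ) (v : Site 2) :
    latticeLaplacian (fun z : Site 2 => d * (((z 1 : ℤ) : ℝ) - c)) v = 0 := by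
  have h := latticeLaplacian_coord (fun _ j => d * (((j : ℤ) : ℝ) - c)) v
  push_cast at h
  have e : (fun z : Site 2 => d * (((z 1 : ℤ) : ℝ) - c)) =
      fun y : Site 2 => (fun (_ j : ℤ) => d * (((j : ℤ) : ℝ) - c)) (y 0) (y 1) := rfl
  rw [e, h]; ring

/-- **The rectangle squeeze at the normalisation point (static form).** In the frame `σ` of the
flat boundary point at `a` (window of width `W`), with the rectangle `2S × T` standing on the
killed row below `σ a` (`2 ≤ T`, `2T ≤ S ≤ W`, pole far away), the normalised kernel
`P = G(·, b) d / G(a, b)` (`G(a,b) ≠ 0`, so `P(a) = d`) minus the affine function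
`d · (z'₁ - (σa)₁ + 1)` is lattice-harmonic in the rectangle, vanishes at `σ a` and on the killed
row, is bounded by `K = K_P + dT` on the vertical sides; hence upper (resp. lower) bounds
`M_hi + dT` (resp. `M_lo + dT`) for `P` on the top row force `-(4K/3)(T/S)² ≤ M_hi` and
`M_lo ≤ (4K/3)(T/S)²` (`RectangleSideHarmonicMeasure.top_ge_neg_of_squeeze`, `top_le_of_squeeze`;
Chelkak–Smirnov 2011, Lemma 3.12 and the end of the proof of Thm. 3.13). [folklore] -/
theorem squeeze_rect {d : ℝ} (hd : 0 < d) {Λ : Finset (Site 2)} {a b : Site 2} (o : Orient) {W S T : ℕ}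
    (hwin : ∀ z' : Site 2, |z' 0 - frame o a 0| ≤ W → |z' 1 - frame o a 1| ≤ W →
      (z' ∈ Λ.map (frame o).toEmbedding ↔ frame o a 1 ≤ z' 1))
    (hT : 2 ≤ T) (hST : 2 * T ≤ S) (hSW : S ≤ W)
    (hfar : (S : ℤ) ≤ |frame o b 0 - frame o a 0| ∨ (T : ℤ) ≤ |frame o b 1 - frame o a 1| + 1)
    (hG : dirichletGreen Λ a b ≠ 0) {Kp Mhi Mlo : ℝ} (hKp : 0 ≤ Kp)
    (hside : ∀ z' : Site 2, (z' 0 = frame o a 0 - S ∨ z' 0 = frame o a 0 - S + 2 * S) →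
      frame o a 1 - 1 < z' 1 → z' 1 < frame o a 1 - 1 + T →
      dirichletGreen Λ ((frame o).symm z') b * d / dirichletGreen Λ a b ≤ Kp)
    (htop_hi : ∀ z' : Site 2, z' 1 = frame o a 1 - 1 + T → frame o a 0 - S < z' 0 → z' 0 < frame o a 0 - S + 2 * S →
      dirichletGreen Λ ((frame o).symm z') b * d / dirichletGreen Λ a b ≤ Mhi + d * T)
    (htop_lo : ∀ z' : Site 2, z' 1 = frame o a 1 - 1 + T → frame o a 0 - S < z' 0 → z' 0 < frame o a 0 - S + 2 * S →
      Mlo + d * T ≤ dirichletGreen Λ ((frame o).symm z') b * d / dirichletGreen Λ a b) :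
    -(4 * (Kp + d * T) / 3) * ((T : ℝ) ^ 2 / (S : ℝ) ^ 2) ≤ Mhi ∧
      Mlo ≤ 4 * (Kp + d * T) / 3 * ((T : ℝ) ^ 2 / (S : ℝ) ^ 2) := by
  set σ := frame o with hσ
  set Λ' := Λ.map σ.toEmbedding with hΛ'
  set α : Site 2 := ![σ a 0 - S, σ a 1 - 1] with hα
  have hα0 : α 0 = σ a 0 - S := rfl
  have hα1 : α 1 = σ a 1 - 1 := rfl
  set Pf : Site 2 → ℝ := fun z' => dirichletGreen Λ (σ.symm z') b * d / dirichletGreen Λ a b with hPf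
  set Q : Site 2 → ℝ := fun z' => Pf z' - d * (((z' 1 : ℤ) : ℝ) - ((α 1 : ℤ) : ℝ)) with hQ
  -- `Pf` through the mapped set
  have hPf' : Pf = fun z' => dirichletGreen Λ' z' (σ b) * d / dirichletGreen Λ' (σ a) (σ b) := by
    funext z'
    rw [hPf, hΛ', hσ, dirichletGreen_map_motion (frame o) (isLatticeMotion_frame o) Λ a b]
    simp only
    conv_rhs => rw [← (frame o).apply_symm_apply z']
    rw [dirichletGreen_map_motion (frame o) (isLatticeMotion_frame o) Λ]
  have hRa : rectInterior α (2 * S) T ⊆ (↑Λ' : Set (Site 2)) \ {σ b} :=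
    rectInterior_subset_of_window hwin hSW (by omega) hfar hα0 hα1
  have hQharm : IsLatticeHarmonicOn Q (rectInterior α (2 * S) T) := by
    intro v hv
    rw [hQ, show (fun z' => Pf z' - d * (((z' 1 : ℤ) : ℝ) - ((α 1 : ℤ) : ℝ))) =
      Pf - fun z' : Site 2 => d * (((z' 1 : ℤ) : ℝ) - ((α 1 : ℤ) : ℝ)) from rfl, latticeLaplacian_sub, hPf',
      latticeLaplacian_ratio _ _ _ _ (hRa hv), latticeLaplacian_affine_snd, sub_zero]
  -- the value at the base point
  have hQo : Q (σ a) = 0 := by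
    simp only [hQ, hPf, Equiv.symm_apply_apply, mul_div_cancel_left₀ d hG, hα1]
    push_cast; ring
  -- the killed row
  have hW1 : (1 : ℤ) ≤ W := by omega
  have hL : ∀ z' : Site 2, z' 1 = α 1 → α 0 < z' 0 → z' 0 < α 0 + 2 * S → Q z' = 0 := by
    intro z' h1 h0 h0'
    rw [hα0] at h0 h0'; rw [hα1] at h1
    have hnot : z' ∉ Λ' := by
      intro hz'
      have := (hwin z' (by rw [abs_le]; constructor <;> omega) (by rw [abs_le]; constructor <;> omega)).1 hz'
      omega
    have hnot' : σ.symm z' ∉ Λ := fun h => hnot (Finset.mem_map_equiv.2 h)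
    simp only [hQ, hPf, ratio_of_not_mem _ _ _ hnot', h1, hα1, sub_self, mul_zero]
  -- the vertical sides
  have hK0 : 0 ≤ Kp + d * T := by positivity
  have hVle : ∀ z' : Site 2, (z' 0 = α 0 ∨ z' 0 = α 0 + 2 * S) → α 1 < z' 1 → z' 1 < α 1 + T → Q z' ≤ Kp + d * T := by
    intro z' h0 h1 h1'
    rw [hα0] at h0; rw [hα1] at h1 h1'
    have hP := hside z' h0 h1 h1'
    have hlin : 0 ≤ d * (((z' 1 : ℤ) : ℝ) - ((α 1 : ℤ) : ℝ)) := by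
      rw [hα1]; push_cast
      have : (frame o a 1 : ℝ) - 1 < z' 1 := by exact_mod_cast h1
      nlinarith
    simp only [hQ, hPf]
    have hT0 : (0 : ℝ) ≤ d * T := by positivity
    linarith
  have hVge : ∀ z' : Site 2, (z' 0 = α 0 ∨ z' 0 = α 0 + 2 * S) → α 1 < z' 1 → z' 1 < α 1 + T → -(Kp + d * T) ≤ Q z' := by
    intro z' h0 h1 h1'
    rw [hα1] at h1 h1'
    have hP : 0 ≤ Pf z' := ratio_nonneg _ _ _ _ hd.le
    have hlin : d * (((z' 1 : ℤ) : ℝ) - ((α 1 : ℤ) : ℝ)) ≤ d * T := by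
      rw [hα1]; push_cast
      have : (z' 1 : ℝ) < (frame o a 1 : ℝ) - 1 + T := by exact_mod_cast h1'
      nlinarith
    simp only [hQ]
    linarith
  -- the top row
  have hUle : ∀ z' : Site 2, z' 1 = α 1 + T → α 0 < z' 0 → z' 0 < α 0 + 2 * S → Q z' ≤ Mhi := by
    intro z' h1 h0 h0'
    rw [hα0] at h0 h0'; rw [hα1] at h1
    have hP := htop_hi z' h1 h0 h0'
    simp only [hQ, hPf, h1, hα1]
    push_cast; linarith
  have hUge : ∀ z' : Site 2, z' 1 = α 1 + T → α 0 < z' 0 → z' 0 < α 0 + 2 * S → Mlo ≤ Q z' := by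
    intro z' h1 h0 h0'
    rw [hα0] at h0 h0'; rw [hα1] at h1
    have hP := htop_lo z' h1 h0 h0'
    simp only [hQ, hPf, h1, hα1]
    push_cast; linarith
  have ho0 : σ a 0 = α 0 + S := by rw [hα0]; ring
  have ho1 : σ a 1 = α 1 + 1 := by rw [hα1]; ring
  exact ⟨top_ge_neg_of_squeeze hT hST hQharm hK0 hUle hVle (fun z' h1 h0 h0' => (hL z' h1 h0 h0').le) ho0 ho1 hQo,
    top_le_of_squeeze hT hST hQharm hK0 hUge hVge (fun z' h1 h0 h0' => (hL z' h1 h0 h0').ge) ho0 ho1 hQo⟩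

end Squeeze

/-! ### The continuum input at the normalisation point -/

section Continuum

/-- The tangent direction of the expansion lemma: `-i ν = ± e`. [folklore] -/
theorem neg_I_mul_ν_eq (o : Orient) : ∃ ι : ℝ, (ι = 1 ∨ ι = -1) ∧ -I * ν o = (ι : ℂ) * e o := by
  cases o
  · exact ⟨1, Or.inl rfl, by simp [ν, e]⟩
  · exact ⟨-1, Or.inr rfl, by simp [ν, e]⟩
  · exact ⟨-1, Or.inr rfl, by simp [ν, e]⟩
  · exact ⟨1, Or.inl rfl, by simp [ν, e]⟩

/-- `|-i ν| = 1`. [folklore] -/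
theorem norm_neg_I_mul_ν (o : Orient) : ‖-I * ν o‖ = 1 := by
  rw [norm_mul, norm_neg, norm_I, norm_ν, one_mul]

/-- `(-i ν)(τ + t i) = (ιτ) e + t ν`. [folklore] -/
theorem neg_I_mul_ν_mul (o : Orient) {ι : ℝ} (hι : -I * ν o = (ι : ℂ) * e o) (τ t : ℝ) :
    -I * ν o * ((τ : ℂ) + (t : ℂ) * I) = ((ι * τ : ℝ) : ℂ) * e o + (t : ℂ) * ν o := by
  have h1 : -I * ν o * ((τ : ℂ) + (t : ℂ) * I) = (τ : ℂ) * (-I * ν o) + (t : ℂ) * ν o * (-(I * I)) := by ring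
  rw [h1, I_mul_I, neg_neg, mul_one, hι]
  push_cast; ring

/-- **The continuum input at the flat normalisation point.** For the Jordan domain `D`, flat at the
boundary point `x` with orientation `o` (inside `B(x, r₀)`: `D̄ = {nrmC x ≤ nrmC}`,
`D = {nrmC x < nrmC}`), `w` holomorphic on an open `U ⊇ D ∪ {x, y}` mapping `D` bijectively onto
`ℍ`, and `y ≠ x` another boundary point: `w y` is real, `w x ≠ w y`, `w′(x) ≠ 0`
(`DerivNeZeroOfHalfDisc`), and the Poisson quotient expands at `x` along the inner normal:
`|Im w(ξ)/|w(ξ) - w(y)|² - t |w′x|/|wx - wy|²| ≤ C(|τ| t + t²)` for `ξ = x + (-iν)(τ + ti)`,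
`|τ|, t ≤ ρ₁` (`FlatBoundaryPoissonExpansion.abs_poisson_sub_mul_le`). [folklore] -/
theorem flat_point_expansion (Dj : JordanDomain) {x y : ℂ} (hx : x ∈ frontier Dj.carrier)
    (hy : y ∈ frontier Dj.carrier) (hxy : x ≠ y) (o : Orient) {r₀ : ℝ} (hr₀ : 0 < r₀)
    (hsx : ∀ z, dist z x < r₀ → (z ∈ closure Dj.carrier ↔ nrmC o x ≤ nrmC o z))
    (hsx' : ∀ z, dist z x < r₀ → (z ∈ Dj.carrier ↔ nrmC o x < nrmC o z))
    {w : ℂ → ℂ} {U : Set ℂ} (hU : IsOpen U) (hDU : Dj.carrier ⊆ U) (hxU : x ∈ U) (hyU : y ∈ U)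
    (hw : DifferentiableOn ℂ w U) (hbij : BijOn w Dj.carrier {z : ℂ | 0 < z.im}) :
    (w y).im = 0 ∧ w x ≠ w y ∧ deriv w x ≠ 0 ∧
    ∃ C ρ₁ : ℝ, 0 ≤ C ∧ 0 < ρ₁ ∧ ∀ τ t : ℝ, |τ| ≤ ρ₁ → 0 ≤ t → t ≤ ρ₁ →
      |(w (x + -I * ν o * ((τ : ℂ) + (t : ℂ) * I))).im / ‖w (x + -I * ν o * ((τ : ℂ) + (t : ℂ) * I)) - w y‖ ^ 2 -
        t * (‖deriv w x‖ / ‖w x - w y‖ ^ 2)| ≤ C * (|τ| * t + t ^ 2) := by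
  set D := Dj.carrier with hDdef
  have hDo : IsOpen D := Dj.isOpen
  have hbij' : BijOn w D UpperHalfPlane.upperHalfPlaneSet := hbij
  obtain ⟨Φ, -, -, -, -, -, hbdry⟩ := Dj.exists_extension_comp_cayleyFun_eq hU hDU hw hbij'
  have hyreal : (w y).im = 0 := (hbdry y hy hyU).1
  have hxreal : (w x).im = 0 := (hbdry x hx hxU).1
  have hne : w x ≠ w y := Dj.apply_ne_apply_of_mem_frontier hU hDU hw hbij hx hxU hy hyU hxy
  have hwy : (((w y).re : ℝ) : ℂ) = w y := by
    apply Complex.ext <;> simp [hyreal]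
  obtain ⟨ρU, hρU, hballU⟩ := Metric.isOpen_iff.1 hU x hxU
  set ρf := min r₀ ρU with hρf
  have hρf0 : 0 < ρf := by positivity
  have hρfr : ρf ≤ r₀ := min_le_left _ _
  have hρfU : ρf ≤ ρU := min_le_right _ _
  obtain ⟨ι, hι, hνL⟩ := neg_I_mul_ν_eq o
  have hwx : AnalyticAt ℂ w x := hw.analyticAt (hU.mem_nhds hxU)
  -- points along the boundary line
  have hflat : ∀ τ : ℝ, |τ| < ρf → (w (x + -I * ν o * (τ : ℂ))).im = 0 := by
    intro τ hτ
    have heq : -I * ν o * (τ : ℂ) = ((ι * τ : ℝ) : ℂ) * e o + ((0 : ℝ) : ℂ) * ν o := by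
      have := neg_I_mul_ν_mul o hνL τ 0; simpa using this
    set p := x + -I * ν o * (τ : ℂ) with hp
    have hdist : dist p x < ρf := by
      rw [hp, dist_eq_norm, add_sub_cancel_left, norm_mul, norm_neg_I_mul_ν, one_mul, norm_real,
        Real.norm_eq_abs]
      exact hτ
    have hnrm : nrmC o p = nrmC o x := by rw [hp, heq, nrmC_add_combo, add_zero]
    have hcl : p ∈ closure D := (hsx p (lt_of_lt_of_le hdist hρfr)).2 hnrm.ge
    have hnot : p ∉ D := fun h => by
      have := (hsx' p (lt_of_lt_of_le hdist hρfr)).1 h; rw [hnrm] at this; exact lt_irrefl _ this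
    have hfr : p ∈ frontier D := by
      rw [frontier, hDo.interior_eq]; exact ⟨hcl, hnot⟩
    exact (hbdry p hfr (hballU (lt_of_lt_of_le hdist hρfU))).1
  -- points along the inner normal
  have hinD : ∀ (σ' t' : ℝ), |σ'| + |t'| < r₀ → 0 < t' → x + (((σ' : ℝ) : ℂ) * e o + (t' : ℂ) * ν o) ∈ D := by
    intro σ' t' h1 h2
    refine (hsx' _ ?_).2 (by rw [nrmC_add_combo]; linarith)
    rw [dist_eq_norm, add_sub_cancel_left]
    exact lt_of_le_of_lt (norm_combo_le o σ' t') h1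
  have hpos : ∀ t : ℝ, 0 < t → t < ρf → 0 < (w (x + -I * ν o * ((t : ℂ) * I))).im := by
    intro t ht htρ
    have heq : -I * ν o * ((t : ℂ) * I) = ((ι * 0 : ℝ) : ℂ) * e o + (t : ℂ) * ν o := by
      have := neg_I_mul_ν_mul o hνL 0 t; simpa using this
    rw [heq]
    exact hbij.mapsTo (hinD _ _ (by rw [mul_zero, abs_zero, zero_add, abs_of_pos ht]; linarith) ht)
  have hc : w x ≠ (((w y).re : ℝ) : ℂ) := by rw [hwy]; exact hne
  obtain ⟨C, ρ₁, hC, hρ₁, hexp⟩ :=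
    Literature.Analysis.Complex.abs_poisson_sub_mul_le hwx (norm_neg_I_mul_ν o) hρf0 hflat hpos hc
  -- `w′(x) ≠ 0`
  have hderiv : deriv w x ≠ 0 := by
    refine Literature.Analysis.Complex.deriv_ne_zero_of_im_lt (-I * ν o) hwx (half_pos hρf0) fun ζ hζ hζim => ?_
    rw [hxreal]
    have heq : -I * ν o * ζ = ((ι * ζ.re : ℝ) : ℂ) * e o + (ζ.im : ℂ) * ν o := by
      conv_lhs => rw [← re_add_im ζ]
      exact neg_I_mul_ν_mul o hνL ζ.re ζ.im
    rw [heq]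
    refine hbij.mapsTo (hinD _ _ ?_ hζim)
    have h1 : |ι * ζ.re| = |ζ.re| := by
      rw [abs_mul]; rcases hι with rfl | rfl <;> simp
    rw [h1, abs_of_pos hζim]
    calc |ζ.re| + ζ.im ≤ |ζ.re| + |ζ.im| := by linarith [le_abs_self ζ.im]
      _ ≤ ‖ζ‖ + ‖ζ‖ := add_le_add (abs_re_le_norm ζ) (abs_im_le_norm ζ)
      _ < r₀ := by linarith
  refine ⟨hyreal, hne, hderiv, C, ρ₁, hC, hρ₁, fun τ t hτ ht htρ => ?_⟩
  have := hexp τ t hτ ht htρ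
  rwa [hwy] at this

end Continuum

/-! ### The normalisation `m · |w′(x)|/|w(x) - w(y)|² = 1` -/

section Normalisation

variable {δ : ℕ → ℝ} {V : ℕ → Finset (Site 2)}

/-- A natural-number inequality from the real one multiplied by `d > 0`. [folklore] -/
private theorem natLe_of_mul_le' {m n : ℕ} {d : ℝ} (hd : 0 < d) (h : (m : ℝ) * d ≤ n * d) : m ≤ n := by
  exact_mod_cast le_of_mul_le_mul_right h hd

/-- **The scales of the squeeze**: `2 ≤ T`, `2T ≤ S ≤ W`, `0 < S`, `(T/S)² ≤ 4t²/s²`. [folklore] -/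
theorem squeeze_scales {d s t r₀ : ℝ} {S T W : ℕ} (hd : 0 < d) (ht : 0 < t) (hdt : 8 * d ≤ t)
    (hts : 3 * t ≤ s) (hsr : s ≤ r₀ / 8)
    (hSd' : s - d ≤ S * d) (hSd : (S : ℝ) * d ≤ s) (hTd' : t - d ≤ T * d) (hTd : (T : ℝ) * d ≤ t)
    (hWd' : r₀ / 4 - d ≤ W * d) :
    2 ≤ T ∧ 2 * T ≤ S ∧ S ≤ W ∧ 0 < S ∧ (T : ℝ) ^ 2 / (S : ℝ) ^ 2 ≤ 4 * (t ^ 2 / s ^ 2) := by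
  have hS0r : (0 : ℝ) < S := by
    by_contra hcon
    push Not at hcon
    have : (S : ℝ) * d ≤ 0 := mul_nonpos_of_nonpos_of_nonneg hcon hd.le
    linarith
  refine ⟨natLe_of_mul_le' hd (by push_cast; linarith), natLe_of_mul_le' hd (by push_cast; linarith),
    natLe_of_mul_le' hd (by linarith), by exact_mod_cast hS0r, ?_⟩
  have hs0 : 0 < s := by linarith
  have hTS : (T : ℝ) / S ≤ 2 * t / s := by
    rw [div_le_div_iff₀ hS0r hs0]
    refine le_of_mul_le_mul_right ?_ hd
    have e1 : (T : ℝ) * s * d = s * (T * d) := by ring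
    have e2 : 2 * t * (S : ℝ) * d = 2 * t * (S * d) := by ring
    rw [e1, e2]
    have h1 : s * ((T : ℝ) * d) ≤ s * t := mul_le_mul_of_nonneg_left hTd hs0.le
    have h2 : 2 * t * (s - d) ≤ 2 * t * ((S : ℝ) * d) := mul_le_mul_of_nonneg_left hSd' (by positivity)
    nlinarith
  have h0 : 0 ≤ (T : ℝ) / S := by positivity
  calc (T : ℝ) ^ 2 / (S : ℝ) ^ 2 = ((T : ℝ) / S) ^ 2 := by rw [div_pow]
    _ ≤ (2 * t / s) ^ 2 := pow_le_pow_left₀ h0 hTS 2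
    _ = 4 * (t ^ 2 / s ^ 2) := by rw [div_pow]; ring

/-- **The mesh point of a top-row site through the expansion point**: with `τ = ι d (z'₀ - (σa)₀)`,
`meshPoint d (σ⁻¹ z') = x + (-iν)(τ + ti) + ((meshPoint d a - x) + (Td - d - t)ν)`. [folklore] -/
theorem meshPoint_symm_top (o : Orient) {ι : ℝ} (hι : -I * ν o = (ι : ℂ) * e o) (hι1 : ι = 1 ∨ ι = -1)
    (d : ℝ) (a : Site 2) (x : ℂ) (t : ℝ) {T : ℕ} {z' : Site 2} (hz1 : z' 1 = frame o a 1 - 1 + T) :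
    meshPoint d ((frame o).symm z') =
      x + -I * ν o * ((((ι * d * ((z' 0 - frame o a 0 : ℤ) : ℝ)) : ℝ) : ℂ) + (t : ℂ) * I) +
        ((meshPoint d a - x) + ((((T : ℝ) * d - d - t : ℝ)) : ℂ) * ν o) := by
  rw [neg_I_mul_ν_mul o hι, meshPoint_frame_symm o d a z', hz1]
  have hι2 : ι * (ι * d * ((z' 0 - frame o a 0 : ℤ) : ℝ)) = d * ((z' 0 - frame o a 0 : ℤ) : ℝ) := by
    rcases hι1 with rfl | rfl <;> ring
  rw [hι2]
  push_cast; ring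

/-- Distance of the mesh point of a frame site from `meshPoint a`. [folklore] -/
theorem dist_meshPoint_symm_le (o : Orient) {d : ℝ} (hd : 0 ≤ d) (a z' : Site 2) {S T : ℕ}
    (h0 : |z' 0 - frame o a 0| ≤ S) (h1 : |z' 1 - frame o a 1| ≤ T) :
    dist (meshPoint d ((frame o).symm z')) (meshPoint d a) ≤ ((S : ℝ) + T) * d := by
  rw [meshPoint_frame_symm o d a z', dist_eq_norm, add_sub_cancel_left, norm_mul, norm_real, Real.norm_eq_abs,
    abs_of_nonneg hd]
  have h := norm_combo_le o (((z' 0 - frame o a 0 : ℤ) : ℝ)) (((z' 1 - frame o a 1 : ℤ) : ℝ))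
  have h0' : |((z' 0 - frame o a 0 : ℤ) : ℝ)| ≤ S := by rw [← Int.cast_abs]; exact_mod_cast h0
  have h1' : |((z' 1 - frame o a 1 : ℤ) : ℝ)| ≤ T := by rw [← Int.cast_abs]; exact_mod_cast h1
  nlinarith [norm_nonneg ((((z' 0 - frame o a 0 : ℤ) : ℝ) : ℂ) * e o + (((z' 1 - frame o a 1 : ℤ) : ℝ) : ℂ) * ν o)]

/-- Normal coordinate of the mesh point of a frame site. [folklore] -/
theorem nrmC_meshPoint_symm (o : Orient) (d : ℝ) (a z' : Site 2) :
    nrmC o (meshPoint d ((frame o).symm z')) = nrmC o (meshPoint d a) + d * ((z' 1 - frame o a 1 : ℤ) : ℝ) := by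
  rw [meshPoint_frame_symm o d a z']
  have : (d : ℂ) * ((((z' 0 - frame o a 0 : ℤ) : ℝ) : ℂ) * e o + (((z' 1 - frame o a 1 : ℤ) : ℝ) : ℂ) * ν o) =
      (((d * ((z' 0 - frame o a 0 : ℤ) : ℝ) : ℝ)) : ℂ) * e o + (((d * ((z' 1 - frame o a 1 : ℤ) : ℝ) : ℝ)) : ℂ) * ν o := by
    push_cast; ring
  rw [this, nrmC_add_combo]

/-- **The top-row estimate (static).** For a site `z'` of the top row of the rectangle (frame of
`o` at `a`, half-width `S`, height `T` with `t - d ≤ Td ≤ t`, `Sd ≤ s`), the normalised kernel is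
within `2ε' + 2mCst` of `m t c_x`: its mesh point lies in the compact `K` where the kernels are
`ε'`-close to `H = m·Im w/|w - wy|²`, within `θ` of the point `ξ = x + (-iν)(τ + ti)` of `K`
(`|τ| ≤ s`), where `|H(ξ) - m t c_x| ≤ mC(|τ|t + t²)`. [folklore] -/
theorem top_row_estimate (o : Orient) {ι : ℝ} (hι : -I * ν o = (ι : ℂ) * e o) (hι1 : ι = 1 ∨ ι = -1)
    {dd : ℝ} (hdd0 : 0 < dd) {x y : ℂ} {a : Site 2} {S T : ℕ} {s t θ ε' r₀ ρ₁ m C cx : ℝ}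
    (ht : 0 < t) (hts' : t ≤ s) (hsr : s ≤ r₀ / 8) (hsρ : s ≤ ρ₁) (hm : 0 ≤ m) (hC : 0 ≤ C)
    (hSd : (S : ℝ) * dd ≤ s) (hTd' : t - dd ≤ T * dd) (hTd : (T : ℝ) * dd ≤ t) (hT1 : 1 ≤ T)
    (hdd2 : dd < t / 8) (hdd3 : dd < θ / 4) (ha1 : dist (meshPoint dd a) x < t / 8)
    (ha2 : dist (meshPoint dd a) x < θ / 4)
    {KS : Set ℂ} (hmemK : ∀ z : ℂ, dist z x ≤ r₀ / 2 → nrmC o x + t / 2 ≤ nrmC o z → z ∈ KS)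
    {w : ℂ → ℂ} {Pn : Site 2 → ℝ}
    (hcv : ∀ z ∈ KS, dist (m * ((w z).im / ‖w z - w y‖ ^ 2)) (Pn (nearestSite dd z)) < ε')
    (hθc : ∀ p ∈ KS, ∀ q ∈ KS, dist p q < θ →
      dist (m * ((w p).im / ‖w p - w y‖ ^ 2)) (m * ((w q).im / ‖w q - w y‖ ^ 2)) < ε')
    (hexp : ∀ τ t : ℝ, |τ| ≤ ρ₁ → 0 ≤ t → t ≤ ρ₁ →
      |(w (x + -I * ν o * ((τ : ℂ) + (t : ℂ) * I))).im / ‖w (x + -I * ν o * ((τ : ℂ) + (t : ℂ) * I)) - w y‖ ^ 2 -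
        t * cx| ≤ C * (|τ| * t + t ^ 2))
    {z' : Site 2} (h1 : z' 1 = frame o a 1 - 1 + T) (h0 : frame o a 0 - S < z' 0)
    (h0' : z' 0 < frame o a 0 - S + 2 * S) :
    |Pn ((frame o).symm z') - m * (t * cx)| ≤ 2 * ε' + 2 * m * C * (s * t) := by
  set v := (frame o).symm z' with hv
  set τ : ℝ := ι * dd * ((z' 0 - frame o a 0 : ℤ) : ℝ) with hτ
  set ξ : ℂ := x + -I * ν o * ((τ : ℂ) + (t : ℂ) * I) with hξ
  set E : ℂ := (meshPoint dd a - x) + ((((T : ℝ) * dd - dd - t : ℝ)) : ℂ) * ν o with hE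
  set Hm : ℂ → ℝ := fun z => m * ((w z).im / ‖w z - w y‖ ^ 2) with hHm
  have hmesh : meshPoint dd v = ξ + E := by rw [hv, meshPoint_symm_top o hι hι1 dd a x t h1]
  have habsι : |ι| = 1 := by rcases hι1 with rfl | rfl <;> norm_num
  -- sizes
  have hkZ : |z' 0 - frame o a 0| ≤ (S : ℤ) - 1 := by rw [abs_le]; constructor <;> omega
  have hk : |((z' 0 : ℤ) : ℝ) - ((frame o a 0 : ℤ) : ℝ)| ≤ (S : ℝ) - 1 := by
    have : (((|z' 0 - frame o a 0| : ℤ)) : ℝ) ≤ (((S : ℤ) - 1 : ℤ) : ℝ) := by exact_mod_cast hkZ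
    push_cast at this
    exact this
  have hτs : |τ| ≤ s := by
    rw [hτ, abs_mul, abs_mul, habsι, one_mul, abs_of_pos hdd0]
    push_cast
    nlinarith
  have hEn : ‖E‖ ≤ dist (meshPoint dd a) x + 2 * dd := by
    rw [hE]
    calc ‖(meshPoint dd a - x) + ((((T : ℝ) * dd - dd - t : ℝ)) : ℂ) * ν o‖
        ≤ ‖meshPoint dd a - x‖ + ‖((((T : ℝ) * dd - dd - t : ℝ)) : ℂ) * ν o‖ := norm_add_le _ _
      _ ≤ dist (meshPoint dd a) x + 2 * dd := by
          rw [norm_mul, norm_ν, mul_one, norm_real, Real.norm_eq_abs, ← dist_eq_norm]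
          have : |(T : ℝ) * dd - dd - t| ≤ 2 * dd := by rw [abs_le]; constructor <;> linarith
          linarith
  -- `meshPoint v ∈ KS`
  have hvK : meshPoint dd v ∈ KS := by
    apply hmemK
    · have hdist := dist_meshPoint_symm_le o hdd0.le a z' (S := S) (T := T)
        (by rw [abs_le]; constructor <;> omega) (by rw [abs_le]; constructor <;> omega)
      rw [← hv] at hdist
      have := dist_triangle (meshPoint dd v) (meshPoint dd a) x
      have e : ((S : ℝ) + T) * dd = S * dd + T * dd := by ring
      linarith
    · rw [hv, nrmC_meshPoint_symm o dd a z', h1]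
      push_cast
      have h2 := abs_nrmC_sub_le_norm o (meshPoint dd a) x
      rw [← dist_eq_norm] at h2
      have h3 := (abs_le.1 h2).1
      nlinarith
  -- `ξ ∈ KS`
  have hξeq : ξ = x + ((((ι * τ : ℝ)) : ℂ) * e o + (t : ℂ) * ν o) := by rw [hξ, neg_I_mul_ν_mul o hι]
  have hξK : ξ ∈ KS := by
    apply hmemK
    · rw [hξeq, dist_eq_norm, add_sub_cancel_left]
      have := norm_combo_le o (ι * τ) t
      rw [abs_mul, habsι, one_mul, abs_of_pos ht] at this
      linarith
    · rw [hξeq, nrmC_add_combo]; linarith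
  -- the three comparisons
  have h1' := hcv (meshPoint dd v) hvK
  rw [nearestSite_meshPoint hdd0.ne', Real.dist_eq] at h1'
  have h2' := hθc (meshPoint dd v) hvK ξ hξK (by rw [hmesh, dist_eq_norm, add_sub_cancel_left]; linarith)
  rw [Real.dist_eq] at h2'
  have h3' : |Hm ξ - m * (t * cx)| ≤ 2 * m * C * (s * t) := by
    have h := hexp τ t (hτs.trans hsρ) ht.le (hts'.trans hsρ)
    rw [hHm]
    simp only
    rw [← mul_sub, abs_mul, abs_of_nonneg hm]
    have : C * (|τ| * t + t ^ 2) ≤ C * (s * t + s * t) := by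
      apply mul_le_mul_of_nonneg_left _ hC; nlinarith
    nlinarith
  have hA := abs_sub_le (Pn v) (Hm (meshPoint dd v)) (m * (t * cx))
  have hB := abs_sub_le (Hm (meshPoint dd v)) (Hm ξ) (m * (t * cx))
  have h1'' : |Pn v - Hm (meshPoint dd v)| < ε' := by rw [abs_sub_comm]; exact h1'
  linarith

/-- **The squeeze at one index (static).** [folklore] -/
theorem squeeze_at_index {dd : ℝ} (hdd0 : 0 < dd) {Λ : Finset (Site 2)} {a b : Site 2} (o : Orient) {W S T : ℕ}
    (hwin : ∀ z' : Site 2, |z' 0 - frame o a 0| ≤ W → |z' 1 - frame o a 1| ≤ W →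
      (z' ∈ Λ.map (frame o).toEmbedding ↔ frame o a 1 ≤ z' 1))
    (hT : 2 ≤ T) (hST : 2 * T ≤ S) (hSW : S ≤ W)
    (hfar : (S : ℤ) ≤ |frame o b 0 - frame o a 0| ∨ (T : ℤ) ≤ |frame o b 1 - frame o a 1| + 1)
    (hG : dirichletGreen Λ a b ≠ 0) {Kp m cx ε' C s t : ℝ} (hKp : 0 ≤ Kp)
    (hTd' : t - dd ≤ T * dd) (hTd : (T : ℝ) * dd ≤ t) (hTS : (T : ℝ) ^ 2 / (S : ℝ) ^ 2 ≤ 4 * (t ^ 2 / s ^ 2))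
    (ht1 : t ≤ 1)
    (hside : ∀ z' : Site 2, (z' 0 = frame o a 0 - S ∨ z' 0 = frame o a 0 - S + 2 * S) →
      frame o a 1 - 1 < z' 1 → z' 1 < frame o a 1 - 1 + T →
      dirichletGreen Λ ((frame o).symm z') b * dd / dirichletGreen Λ a b ≤ Kp)
    (htop : ∀ z' : Site 2, z' 1 = frame o a 1 - 1 + T → frame o a 0 - S < z' 0 → z' 0 < frame o a 0 - S + 2 * S →
      |dirichletGreen Λ ((frame o).symm z') b * dd / dirichletGreen Λ a b - m * (t * cx)| ≤ 2 * ε' + 2 * m * C * (s * t)) :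
    (1 - m * cx) * t ≤ 16 * (Kp + 1) / 3 * (t ^ 2 / s ^ 2) + 2 * m * C * (s * t) + 2 * ε' + dd ∧
      (m * cx - 1) * t ≤ 16 * (Kp + 1) / 3 * (t ^ 2 / s ^ 2) + 2 * m * C * (s * t) + 2 * ε' := by
  obtain ⟨hlo', hhi'⟩ := squeeze_rect hdd0 o hwin hT hST hSW hfar hG hKp hside
    (Mhi := m * (t * cx) + 2 * ε' + 2 * m * C * (s * t) - dd * T)
    (Mlo := m * (t * cx) - 2 * ε' - 2 * m * C * (s * t) - dd * T)
    (fun z' h1 h0 h0' => by have := (abs_le.1 (htop z' h1 h0 h0')).2; linarith)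
    (fun z' h1 h0 h0' => by have := (abs_le.1 (htop z' h1 h0 h0')).1; linarith)
  have hTt : dd * T ≤ t := by rw [mul_comm]; exact hTd
  have hTt' : t - dd ≤ dd * T := by rw [mul_comm]; exact hTd'
  have hprod : 4 * (Kp + dd * T) / 3 * ((T : ℝ) ^ 2 / (S : ℝ) ^ 2) ≤ 16 * (Kp + 1) / 3 * (t ^ 2 / s ^ 2) := by
    calc 4 * (Kp + dd * T) / 3 * ((T : ℝ) ^ 2 / (S : ℝ) ^ 2) ≤ 4 * (Kp + 1) / 3 * (4 * (t ^ 2 / s ^ 2)) :=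
          mul_le_mul (by linarith) hTS (by positivity) (by positivity)
      _ = 16 * (Kp + 1) / 3 * (t ^ 2 / s ^ 2) := by ring
  constructor
  · nlinarith
  · nlinarith

/-- **The squeeze at a late index of the subsequence (static bookkeeping).** [folklore] -/
theorem squeeze_main_at {δ : ℕ → ℝ} {V : ℕ → Finset (Site 2)} (hδ : ∀ n, 0 < δ n)
    {x y : ℂ} {ox : Orient} {r₀ : ℝ} (hr₀ : 0 < r₀) (hxy : 4 * r₀ ≤ dist x y)
    {ε' Kp t s ρ₁ m C θ κ : ℝ} (hKp0 : 0 ≤ Kp) (ht : 0 < t) (hts : 3 * t ≤ s)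
    (hsr : s ≤ r₀ / 8) (hsρ : s ≤ ρ₁) (ht1 : t ≤ 1) (hm : 0 ≤ m) (hC : 0 ≤ C) (hκ : 0 < κ)
    {ι : ℝ} (hι : -I * ν ox = (ι : ℂ) * e ox) (hι1 : ι = 1 ∨ ι = -1)
    {KS : Set ℂ} (hmemK : ∀ z : ℂ, dist z x ≤ r₀ / 2 → nrmC ox x + t / 2 ≤ nrmC ox z → z ∈ KS)
    {w : ℂ → ℂ} {cx : ℝ}
    (hexp : ∀ τ t : ℝ, |τ| ≤ ρ₁ → 0 ≤ t → t ≤ ρ₁ →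
      |(w (x + -I * ν ox * ((τ : ℂ) + (t : ℂ) * I))).im / ‖w (x + -I * ν ox * ((τ : ℂ) + (t : ℂ) * I)) - w y‖ ^ 2 -
        t * cx| ≤ C * (|τ| * t + t ^ 2))
    {a b : ℕ → Site 2} {φ : ℕ → ℕ} {k : ℕ}
    (hwin : ∀ z' : Site 2, |z' 0 - frame ox (a (φ k)) 0| ≤ ⌊r₀ / (4 * δ (φ k))⌋₊ →
      |z' 1 - frame ox (a (φ k)) 1| ≤ ⌊r₀ / (4 * δ (φ k))⌋₊ →
      (z' ∈ (V (φ k)).map (frame ox).toEmbedding ↔ frame ox (a (φ k)) 1 ≤ z' 1))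
    (hPK : ∀ z : Site 2, r₀ / 4 ≤ dist (meshPoint (δ (φ k)) z) y →
      dirichletGreen (V (φ k)) z (b (φ k)) * δ (φ k) / dirichletGreen (V (φ k)) (a (φ k)) (b (φ k)) ≤ Kp)
    (hlo : κ * δ (φ k) ^ 2 ≤ dirichletGreen (V (φ k)) (a (φ k)) (b (φ k)))
    (hd4 : δ (φ k) < min ε' (min (t / 8) (θ / 4)))
    (ha5 : dist (meshPoint (δ (φ k)) (a (φ k))) x < min (t / 8) (θ / 4))
    (hb6 : dist (meshPoint (δ (φ k)) (b (φ k))) y < r₀)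
    (hcv : ∀ z ∈ KS, dist (m * ((w z).im / ‖w z - w y‖ ^ 2))
      (dirichletGreen (V (φ k)) (nearestSite (δ (φ k)) z) (b (φ k)) * δ (φ k) /
        dirichletGreen (V (φ k)) (a (φ k)) (b (φ k))) < ε')
    (hθc : ∀ p ∈ KS, ∀ q ∈ KS, dist p q < θ →
      dist (m * ((w p).im / ‖w p - w y‖ ^ 2)) (m * ((w q).im / ‖w q - w y‖ ^ 2)) < ε') :
    (1 - m * cx) * t ≤ 16 * (Kp + 1) / 3 * (t ^ 2 / s ^ 2) + 2 * m * C * (s * t) + 2 * ε' + δ (φ k) ∧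
      (m * cx - 1) * t ≤ 16 * (Kp + 1) / 3 * (t ^ 2 / s ^ 2) + 2 * m * C * (s * t) + 2 * ε' := by
  set n := φ k with hn
  set dd := δ n with hdd
  have hdd0 : 0 < dd := hδ n
  have hdd2 : dd < t / 8 := lt_of_lt_of_le hd4 ((min_le_right _ _).trans (min_le_left _ _))
  have hdd3 : dd < θ / 4 := lt_of_lt_of_le hd4 ((min_le_right _ _).trans (min_le_right _ _))
  have ha1 : dist (meshPoint dd (a n)) x < t / 8 := lt_of_lt_of_le ha5 (min_le_left _ _)
  have ha2 : dist (meshPoint dd (a n)) x < θ / 4 := lt_of_lt_of_le ha5 (min_le_right _ _)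
  have hts' : t ≤ s := by linarith
  have hG : dirichletGreen (V n) (a n) (b n) ≠ 0 := (lt_of_lt_of_le (by positivity) hlo).ne'
  -- the scales
  obtain ⟨hSd', hSd⟩ := floor_mul_bounds (show (0 : ℝ) ≤ s by linarith) hdd0
  obtain ⟨hTd', hTd⟩ := floor_mul_bounds ht.le hdd0
  have hr4 : (0 : ℝ) ≤ r₀ / 4 := by positivity
  obtain ⟨hWd', -⟩ := floor_mul_bounds hr4 hdd0
  rw [show r₀ / 4 / dd = r₀ / (4 * dd) by rw [div_div]] at hWd'
  set S : ℕ := ⌊s / dd⌋₊ with hS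
  set T : ℕ := ⌊t / dd⌋₊ with hT
  set W : ℕ := ⌊r₀ / (4 * dd)⌋₊ with hW
  obtain ⟨hT2, hST, hSW, hS0, hTS⟩ := squeeze_scales hdd0 ht (by linarith) hts hsr hSd' hSd hTd' hTd hWd'
  -- the pole is far from the rectangle
  have hfar : (S : ℤ) ≤ |frame ox (b n) 0 - frame ox (a n) 0| ∨ (T : ℤ) ≤ |frame ox (b n) 1 - frame ox (a n) 1| + 1 := by
    have hR : 2 * dd * ((S : ℝ) + T) < ‖meshPoint dd (b n) - meshPoint dd (a n)‖ := by
      have h4 := dist_triangle4 x (meshPoint dd (a n)) (meshPoint dd (b n)) y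
      have e1 : dist x (meshPoint dd (a n)) = dist (meshPoint dd (a n)) x := dist_comm _ _
      have e2 : dist (meshPoint dd (a n)) (meshPoint dd (b n)) = ‖meshPoint dd (b n) - meshPoint dd (a n)‖ := by
        rw [dist_comm, dist_eq_norm]
      rw [e1, e2] at h4
      have e3 : 2 * dd * ((S : ℝ) + T) = 2 * (S * dd) + 2 * (T * dd) := by ring
      rw [e3]; linarith
    have hT0 : (0 : ℝ) ≤ T := by positivity
    have hS0' : (0 : ℝ) ≤ S := by positivity
    rcases lt_abs_frame_sub_or ox hdd0 hR with h | h
    · left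
      have : (S : ℝ) < |((frame ox (b n) 0 - frame ox (a n) 0 : ℤ) : ℝ)| := by linarith
      rw [← Int.cast_abs] at this
      exact_mod_cast this.le
    · right
      have : (T : ℝ) < |((frame ox (b n) 1 - frame ox (a n) 1 : ℤ) : ℝ)| := by linarith
      rw [← Int.cast_abs] at this
      have h' : (T : ℤ) < |frame ox (b n) 1 - frame ox (a n) 1| := by exact_mod_cast this
      omega
  -- the vertical sides are far from `y`
  have hside : ∀ z' : Site 2, (z' 0 = frame ox (a n) 0 - S ∨ z' 0 = frame ox (a n) 0 - S + 2 * S) →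
      frame ox (a n) 1 - 1 < z' 1 → z' 1 < frame ox (a n) 1 - 1 + T →
      dirichletGreen (V n) ((frame ox).symm z') (b n) * dd / dirichletGreen (V n) (a n) (b n) ≤ Kp := by
    intro z' h0 h1 h1'
    apply hPK
    have hdist := dist_meshPoint_symm_le ox hdd0.le (a n) z' (S := S) (T := T)
      (by rw [abs_le]; constructor <;> omega) (by rw [abs_le]; constructor <;> omega)
    have h4 := dist_triangle4 x (meshPoint dd (a n)) (meshPoint dd ((frame ox).symm z')) y
    have e1 : dist x (meshPoint dd (a n)) = dist (meshPoint dd (a n)) x := dist_comm _ _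
    have e2 : dist (meshPoint dd (a n)) (meshPoint dd ((frame ox).symm z')) =
        dist (meshPoint dd ((frame ox).symm z')) (meshPoint dd (a n)) := dist_comm _ _
    rw [e1, e2] at h4
    have : ((S : ℝ) + T) * dd = S * dd + T * dd := by ring
    linarith
  -- the top row and the squeeze
  exact squeeze_at_index hdd0 ox hwin hT2 hST hSW hfar hG hKp0 hTd' hTd hTS ht1 hside
    (fun z' h1 h0 h0' => top_row_estimate ox hι hι1 hdd0 ht hts' hsr hsρ hm hC hSd hTd' hTd (by omega) hdd2 hdd3 ha1 ha2 hmemK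
      (Pn := fun v => dirichletGreen (V n) v (b n) * dd / dirichletGreen (V n) (a n) (b n)) hcv hθc hexp h1 h0 h0')

/-- **The squeeze inequality.** In the setting of the theorem, with the subsequential limit
`m · Im w/|w - wy|²` of the normalised kernels along `φ` and the expansion constant `C, ρ₁` at `x`:
for `0 < t`, `3t ≤ s ≤ min(ρ₁, r₀/8)`,
`|m c_x - 1| t ≤ (16 (K_P + 1)/3) t²/s² + 2 m C s t` where `c_x = |w′x|/|wx - wy|²` and
`K_P = 64 C_A/(κ r₀/4)` (the rectangle squeeze `squeeze_rect` at a late index of the subsequence,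
top-row values from the uniform convergence and the expansion, side values from the a priori
bound; Chelkak–Smirnov 2011, end of the proof of Thm. 3.13). [folklore] -/
theorem squeeze_ineq (Dj : JordanDomain) (hδ : ∀ n, 0 < δ n) (hδ0 : Tendsto δ atTop (𝓝 0))
    (hV : ∀ n (v : Site 2), v ∈ V n ↔ meshPoint (δ n) v ∈ closure Dj.carrier)
    {x y : ℂ} {ox oy : Orient} {r₀ : ℝ} (hr₀ : 0 < r₀) (hr₀1 : r₀ ≤ 1) (hxy : 4 * r₀ ≤ dist x y)
    (hsx : ∀ z, dist z x < r₀ → (z ∈ closure Dj.carrier ↔ nrmC ox x ≤ nrmC ox z))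
    (hsx' : ∀ z, dist z x < r₀ → (z ∈ Dj.carrier ↔ nrmC ox x < nrmC ox z))
    (hsy : ∀ z, dist z y < r₀ → (z ∈ closure Dj.carrier ↔ nrmC oy y ≤ nrmC oy z))
    {a b : ℕ → Site 2}
    (ha : ∀ n, a n ∈ V n ∧ (((zdGraph 2).neighborFinset (a n)).filter (fun u => u ∉ V n)).card = 1)
    (hb : ∀ n, b n ∈ V n ∧ (((zdGraph 2).neighborFinset (b n)).filter (fun u => u ∉ V n)).card = 1)
    (hax : Tendsto (fun n => meshPoint (δ n) (a n)) atTop (𝓝 x))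
    (hby : Tendsto (fun n => meshPoint (δ n) (b n)) atTop (𝓝 y))
    {κ : ℝ} (hκ : 0 < κ) (hlow : ∀ᶠ n in atTop, κ * δ n ^ 2 ≤ dirichletGreen (V n) (a n) (b n))
    {w : ℂ → ℂ} (hwc : ContinuousOn w Dj.carrier) (hmaps : MapsTo w Dj.carrier {z : ℂ | 0 < z.im})
    (hyreal : (w y).im = 0) {C ρ₁ cx : ℝ} (hC : 0 ≤ C)
    (hexp : ∀ τ t : ℝ, |τ| ≤ ρ₁ → 0 ≤ t → t ≤ ρ₁ →
      |(w (x + -I * ν ox * ((τ : ℂ) + (t : ℂ) * I))).im / ‖w (x + -I * ν ox * ((τ : ℂ) + (t : ℂ) * I)) - w y‖ ^ 2 -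
        t * cx| ≤ C * (|τ| * t + t ^ 2))
    {φ : ℕ → ℕ} (hφ : StrictMono φ) {m : ℝ} (hm : 0 ≤ m)
    (hconv : ∀ K ⊆ Dj.carrier, IsCompact K →
      TendstoUniformlyOn (fun n z => dirichletGreen (V (φ n)) (nearestSite (δ (φ n)) z) (b (φ n)) * δ (φ n) /
        dirichletGreen (V (φ n)) (a (φ n)) (b (φ n))) (fun z => m * ((w z).im / ‖w z - w y‖ ^ 2)) atTop K)
    {s t : ℝ} (ht : 0 < t) (hts : 3 * t ≤ s) (hs : s ≤ min ρ₁ (r₀ / 8)) :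
    |m * cx - 1| * t ≤ 16 * (64 * flatPoleConst / (κ * (r₀ / 4)) + 1) / 3 * (t ^ 2 / s ^ 2) + 2 * m * C * (s * t) := by
  refine le_of_forall_pos_le_add fun ε hε => ?_
  set ε' := ε / 3 with hε'
  have hε'0 : 0 < ε' := by positivity
  have hC_A := flatPoleConst_pos
  set Kp := 64 * flatPoleConst / (κ * (r₀ / 4)) with hKp
  have hKp0 : 0 ≤ Kp := by positivity
  have hsρ : s ≤ ρ₁ := hs.trans (min_le_left _ _)
  have hsr : s ≤ r₀ / 8 := hs.trans (min_le_right _ _)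
  have hts' : t ≤ s := by linarith
  have ht1 : t ≤ 1 := by linarith
  obtain ⟨ι, hι1, hι⟩ := neg_I_mul_ν_eq ox
  -- the compact set at height `≥ t/2` over `x`
  set KS : Set ℂ := closedBall x (r₀ / 2) ∩ {z | nrmC ox x + t / 2 ≤ nrmC ox z} with hKS
  have hKc : IsCompact KS :=
    (isCompact_closedBall x (r₀ / 2)).inter_right (isClosed_le continuous_const (continuous_nrmC ox))
  have hKD : KS ⊆ Dj.carrier := by
    intro z hz
    have h1 := mem_closedBall.1 hz.1
    have h2 : nrmC ox x + t / 2 ≤ nrmC ox z := hz.2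
    exact (hsx' z (by linarith)).2 (by linarith)
  have hmemK : ∀ z : ℂ, dist z x ≤ r₀ / 2 → nrmC ox x + t / 2 ≤ nrmC ox z → z ∈ KS := fun z h1 h2 =>
    ⟨mem_closedBall.2 h1, h2⟩
  -- uniform continuity of the limit on `KS`
  have hHmc : ContinuousOn (fun z => m * ((w z).im / ‖w z - w y‖ ^ 2)) Dj.carrier :=
    continuousOn_poissonConf hwc hmaps hyreal m
  obtain ⟨θ, hθ, hθc⟩ := Metric.uniformContinuousOn_iff.1
    (hKc.uniformContinuousOn_of_continuous (hHmc.mono hKD)) ε' hε'0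
  -- eventually, along the original index and along `φ`
  have hr4 : 0 < r₀ / 4 := by positivity
  have E1 := eventually_window_frame ox hδ hδ0 hV hr₀ hsx ha hax
  have E2 := eventually_ratio_le oy hδ hδ0 hV hr₀ hsy hb hby hκ hlow hr4 le_rfl
  have E4 : ∀ᶠ n in atTop, δ n < min ε' (min (t / 8) (θ / 4)) := hδ0.eventually (gt_mem_nhds (by positivity))
  have E5 : ∀ᶠ n in atTop, dist (meshPoint (δ n) (a n)) x < min (t / 8) (θ / 4) :=
    (Metric.tendsto_nhds.1 hax) _ (by positivity)
  have E6 : ∀ᶠ n in atTop, dist (meshPoint (δ n) (b n)) y < r₀ := (Metric.tendsto_nhds.1 hby) _ hr₀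
  have Eφ := hφ.tendsto_atTop.eventually (((((E1.and E2).and hlow).and E4).and E5).and E6)
  have Econv := (Metric.tendstoUniformlyOn_iff.1 (hconv KS hKD hKc)) ε' hε'0
  obtain ⟨k, ⟨⟨⟨⟨⟨hwin, hPK⟩, hlo⟩, hd4⟩, ha5⟩, hb6⟩, hcv⟩ := (Eφ.and Econv).exists
  -- the index `n = φ k`
  have hmain := squeeze_main_at (δ := δ) (V := V) hδ hr₀ hxy hKp0 ht hts hsr hsρ ht1 hm hC hκ hι hι1 hmemK hexp
    hwin hPK hlo hd4 ha5 hb6 hcv hθc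
  rcases hmain with ⟨h1, h2⟩
  have hdd1 : δ (φ k) < ε' := lt_of_lt_of_le hd4 (min_le_left _ _)
  have e : |m * cx - 1| * t = |(m * cx - 1) * t| := by rw [abs_mul, abs_of_pos ht]
  rw [e, abs_le]
  constructor
  · linarith
  · linarith

end Normalisation

/-! ### The main theorem -/

section Main

variable {δ : ℕ → ℝ} {V : ℕ → Finset (Site 2)}

/-- **Subsequential convergence to the normalised Poisson kernel.** Under the hypotheses of
`ChelkakSmirnov2011_boundaryNormalisedPoissonKernelLimit`, some subsequence of
`G_{V n}(c n, b n) δ n / G_{V n}(a n, b n)` converges to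
`[Im w(u)/|w(u) - w(y)|²]·[|w(x) - w(y)|²/|w′(x)|]` (steps 1–4 of the module docstring).
[cite: ChelkakSmirnov2011, Thm. 3.13 (proof)] -/
theorem exists_subseq_tendsto_kernel (Dj : JordanDomain)
    (hrect : ∃ S : Finset (ℂ × ℂ), (∀ q ∈ S, q.1.re = q.2.re ∨ q.1.im = q.2.im) ∧
      frontier Dj.carrier ⊆ ⋃ q ∈ S, segment ℝ q.1 q.2)
    {x y : ℂ} (hx : x ∈ frontier Dj.carrier) (hy : y ∈ frontier Dj.carrier) (hxy : x ≠ y)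
    (hflx : ∃ r : ℝ, 0 < r ∧ ((∀ z ∈ frontier Dj.carrier, dist z x < r → z.im = x.im) ∨
      (∀ z ∈ frontier Dj.carrier, dist z x < r → z.re = x.re)))
    (hfly : ∃ r : ℝ, 0 < r ∧ ((∀ z ∈ frontier Dj.carrier, dist z y < r → z.im = y.im) ∨
      (∀ z ∈ frontier Dj.carrier, dist z y < r → z.re = y.re)))
    {w : ℂ → ℂ} {U : Set ℂ} (hU : IsOpen U) (hDU : Dj.carrier ⊆ U) (hxU : x ∈ U) (hyU : y ∈ U)
    (hw : DifferentiableOn ℂ w U) (hbij : BijOn w Dj.carrier {z : ℂ | 0 < z.im})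
    (hδ : ∀ n, 0 < δ n) (hδ0 : Tendsto δ atTop (𝓝 0))
    (hV : ∀ n (v : Site 2), v ∈ V n ↔ meshPoint (δ n) v ∈ closure Dj.carrier)
    {a b : ℕ → Site 2}
    (ha : ∀ n, a n ∈ V n ∧ (((zdGraph 2).neighborFinset (a n)).filter (fun u => u ∉ V n)).card = 1)
    (hb : ∀ n, b n ∈ V n ∧ (((zdGraph 2).neighborFinset (b n)).filter (fun u => u ∉ V n)).card = 1)
    (hax : Tendsto (fun n => meshPoint (δ n) (a n)) atTop (𝓝 x))
    (hby : Tendsto (fun n => meshPoint (δ n) (b n)) atTop (𝓝 y))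
    {u : ℂ} (hu : u ∈ Dj.carrier) {c : ℕ → Site 2}
    (hcu : Tendsto (fun n => meshPoint (δ n) (c n)) atTop (𝓝 u)) :
    ∃ φ : ℕ → ℕ, Tendsto (fun n => dirichletGreen (V (φ n)) (c (φ n)) (b (φ n)) * δ (φ n) /
        dirichletGreen (V (φ n)) (a (φ n)) (b (φ n))) atTop
      (𝓝 ((w u).im / ‖w u - w y‖ ^ 2 * (‖w x - w y‖ ^ 2 / ‖deriv w x‖))) := by
  set D := Dj.carrier with hDdef
  have hDo : IsOpen D := Dj.isOpen
  -- orientations and the basic radius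
  obtain ⟨r₁, hr₁, hflx'⟩ := hflx
  obtain ⟨r₂, hr₂, hfly'⟩ := hfly
  obtain ⟨ox, hsx1, hsx2⟩ := exists_orient_of_flat Dj hx hr₁ hflx'
  obtain ⟨oy, hsy1, hsy2⟩ := exists_orient_of_flat Dj hy hr₂ hfly'
  have hdxy : 0 < dist x y := dist_pos.2 hxy
  set r₀ := min (min r₁ r₂) (min (dist x y / 4) 1) with hr₀
  have hr₀0 : 0 < r₀ := by positivity
  have hr₀1 : r₀ ≤ r₁ := (min_le_left _ _).trans (min_le_left _ _)
  have hr₀2 : r₀ ≤ r₂ := (min_le_left _ _).trans (min_le_right _ _)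
  have hr₀xy : 4 * r₀ ≤ dist x y := by
    have : r₀ ≤ dist x y / 4 := (min_le_right _ _).trans (min_le_left _ _); linarith
  have hr₀one : r₀ ≤ 1 := (min_le_right _ _).trans (min_le_right _ _)
  have hsx : ∀ z, dist z x < r₀ → (z ∈ closure D ↔ nrmC ox x ≤ nrmC ox z) := fun z hz =>
    hsx1 z (lt_of_lt_of_le hz hr₀1)
  have hsx' : ∀ z, dist z x < r₀ → (z ∈ D ↔ nrmC ox x < nrmC ox z) := fun z hz =>
    hsx2 z (lt_of_lt_of_le hz hr₀1)
  have hsy : ∀ z, dist z y < r₀ → (z ∈ closure D ↔ nrmC oy y ≤ nrmC oy z) := fun z hz =>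
    hsy1 z (lt_of_lt_of_le hz hr₀2)
  have hsy' : ∀ z, dist z y < r₀ → (z ∈ D ↔ nrmC oy y < nrmC oy z) := fun z hz =>
    hsy2 z (lt_of_lt_of_le hz hr₀2)
  -- the a priori lower bound
  obtain ⟨κ, hκ, hlow⟩ := eventually_sq_le_dirichletGreen hDo Dj.isConnected hδ hδ0 hV hr₀0 hr₀xy hsx hsx' hsy hsy'
    ha hb hax hby
  -- the subsequential limit
  obtain ⟨φ, hφ, m, hm0, hconv⟩ := exists_subseq_tendstoUniformlyOn_kernel Dj hrect hδ hδ0 hV hy oy hr₀0 hsy hb hby hκ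
    hlow hU hDU hyU hw hbij
  -- the continuum input at `x`
  obtain ⟨hyreal, hne, hderiv, C, ρ₁, hC, hρ₁, hexp⟩ :=
    flat_point_expansion Dj hx hy hxy ox hr₀0 hsx hsx' hU hDU hxU hyU hw hbij
  set cx := ‖deriv w x‖ / ‖w x - w y‖ ^ 2 with hcx
  have hwxy : 0 < ‖w x - w y‖ := norm_pos_iff.2 (sub_ne_zero.2 hne)
  have hdn : 0 < ‖deriv w x‖ := norm_pos_iff.2 hderiv
  have hcx0 : 0 < cx := by positivity
  -- the normalisation `m cx = 1`
  have hwc : ContinuousOn w D := hw.continuousOn.mono hDU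
  have hmaps : MapsTo w D {z : ℂ | 0 < z.im} := hbij.mapsTo
  have hmcx : m * cx = 1 := by
    have hsq : ∀ s t : ℝ, 0 < t → 3 * t ≤ s → s ≤ min ρ₁ (r₀ / 8) →
        |m * cx - 1| * t ≤ 16 * (64 * flatPoleConst / (κ * (r₀ / 4)) + 1) / 3 * (t ^ 2 / s ^ 2) +
          2 * m * C * (s * t) := fun s t ht hts hs =>
      squeeze_ineq Dj hδ hδ0 hV hr₀0 hr₀one hr₀xy hsx hsx' hsy ha hb hax hby hκ hlow hwc hmaps hyreal hC hexp hφ hm0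
        hconv ht hts hs
    have hC_A := flatPoleConst_pos
    have := eq_zero_of_squeeze (A := m * cx - 1) (B := 16 * (64 * flatPoleConst / (κ * (r₀ / 4)) + 1) / 3)
      (C := 2 * m * C) (by positivity) (by positivity) (by positivity : 0 < min ρ₁ (r₀ / 8)) hsq
    linarith
  have hmeq : m = ‖w x - w y‖ ^ 2 / ‖deriv w x‖ := by
    rw [hcx] at hmcx
    field_simp at hmcx
    field_simp
    linarith
  -- convergence along `φ` at the points `c (φ n) → u`
  refine ⟨φ, ?_⟩
  obtain ⟨η, hη, hηD⟩ := Metric.isOpen_iff.1 hDo u hu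
  set K := closedBall u (η / 2) with hK
  have hKD : K ⊆ D := fun z hz => hηD (by rw [mem_closedBall] at hz; rw [mem_ball]; linarith)
  have huK : u ∈ K := mem_closedBall_self (by positivity)
  have hunif := hconv K hKD (isCompact_closedBall _ _)
  have hHc : ContinuousWithinAt (fun z => m * ((w z).im / ‖w z - w y‖ ^ 2)) K u :=
    ((continuousOn_poissonConf hwc hmaps hyreal m).mono hKD) u huK
  have hg : Tendsto (fun n => meshPoint (δ (φ n)) (c (φ n))) atTop (𝓝[K] u) := by
    have h1 : Tendsto (fun n => meshPoint (δ (φ n)) (c (φ n))) atTop (𝓝 u) := hcu.comp hφ.tendsto_atTop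
    refine tendsto_nhdsWithin_iff.2 ⟨h1, ?_⟩
    have := (Metric.tendsto_nhds.1 h1) (η / 2) (by positivity)
    filter_upwards [this] with n hn
    exact mem_closedBall.2 hn.le
  have key := hunif.tendsto_comp hHc hg
  have heq : (fun n => dirichletGreen (V (φ n)) (nearestSite (δ (φ n)) (meshPoint (δ (φ n)) (c (φ n)))) (b (φ n)) *
      δ (φ n) / dirichletGreen (V (φ n)) (a (φ n)) (b (φ n))) =
      fun n => dirichletGreen (V (φ n)) (c (φ n)) (b (φ n)) * δ (φ n) / dirichletGreen (V (φ n)) (a (φ n)) (b (φ n)) := by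
    funext n; rw [nearestSite_meshPoint (hδ _).ne']
  rw [heq] at key
  have hL : m * ((w u).im / ‖w u - w y‖ ^ 2) = (w u).im / ‖w u - w y‖ ^ 2 * (‖w x - w y‖ ^ 2 / ‖deriv w x‖) := by
    rw [hmeq]; ring
  rw [hL] at key
  exact key

/-- **Chelkak–Smirnov 2011, Theorem 3.13 (square lattice, flat boundary): the discrete Poisson
kernel with a flat boundary pole, normalised at a flat boundary point, converges to the continuum
Poisson kernel** — discharge of the tree fact
`ChelkakSmirnov2011_boundaryNormalisedPoissonKernelLimit`. Every subsequence has a further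
subsequence converging to the (subsequence-independent) limit (`exists_subseq_tendsto_kernel`),
hence the whole sequence converges (`Filter.tendsto_of_subseq_tendsto`).
[cite: ChelkakSmirnov2011, Thm. 3.13] -/
theorem ChelkakSmirnov2011_boundaryNormalisedPoissonKernelLimit_holds :
    ChelkakSmirnov2011_boundaryNormalisedPoissonKernelLimit := by
  intro Dj hrect x y hx hy hxy hflx hfly w U hU hDU hxU hyU hw hbij δ hδ hδ0 V hV a b ha hb hax hby u hu c _ hcu
  refine tendsto_of_subseq_tendsto fun ns hns => ?_
  obtain ⟨φ, hφ⟩ := exists_subseq_tendsto_kernel Dj hrect hx hy hxy hflx hfly hU hDU hxU hyU hw hbij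
    (δ := δ ∘ ns) (V := V ∘ ns) (fun n => hδ (ns n)) (hδ0.comp hns) (fun n v => hV (ns n) v)
    (a := a ∘ ns) (b := b ∘ ns) (fun n => ha (ns n)) (fun n => hb (ns n)) (hax.comp hns) (hby.comp hns) hu
    (c := c ∘ ns) (hcu.comp hns)
  exact ⟨φ, hφ⟩

end Main

end Literature.Probability.LatticeModels
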